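import Literature.Geometry.Manifold.LocalDeRhamPullbackPair
import Literature.AlgebraicTopology.SingularHomology.DegreeShiftHomology
import Literature.Geometry.Kaehler.MatrixFormLocalCalculus
import HarnessLib

/-!
# The external product `π₁^* η ∧ π₂^* β` with a closed form, on the de Rham complexes of open sets

For `C^∞` manifolds `M` (model `I`) and `N` (model `I'`), a closed smooth `l`-form `β` on `N` and
an open set `W ⊆ M`, the **external product** `η ↦ π₁^* η ∧ π₂^* β` maps `k`-forms on `W` to
`(k + l)`-forms on the open set `π₁⁻¹ W ⊆ M × N` and commutes with `d` (Leibniz rule, `dβ = 0`;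
Bott–Tu (1982), §I.1 (1.1), §I.5 (the map `π₁^*(·) ∧ π₂^* β` behind the Künneth formula)).
We package it as a degree-`l` map of de Rham complexes
(`localDeRhamComplex.extProdMap`, an instance of the tree's `DegShiftMap`), whence the induced maps
`extProdH : Hᵏ(Ω•(W)) → Hⁿ(Ω•(π₁⁻¹ W))` (`k + l = n`), and prove their naturality under
restriction (`extProdH_res`), under `C^∞` maps into `W` in the first factor
(`extProdH_pullbackPair`, maps of pairs), under `C^∞` maps in the second factor (`extProdH_pullbackPair_snd`),
and their compatibility with the Mayer–Vietoris connecting homomorphisms of the de Rham complexes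
of `M` and of `M × N` (`extProdH_δ`; Bott–Tu (1982), §I.2 and §I.5, the ladder used for the
Künneth formula).

## References

* [BottTu1982Forms] R. Bott, L. W. Tu, *Differential Forms in Algebraic Topology* (1982), §I.1 (1.1),
  §I.2 Prop. 2.3, §I.5 (Künneth formula, the maps `π^*(·) ∧ ρ^* φ`).
* [WarnerGTM94] F. W. Warner, *Foundations of Differentiable Manifolds and Lie Groups* (1983),
  2.17, 2.20, 2.22–2.23.
-/

noncomputable section

-- see "Implementation notes" in `…SingularHomology.SingularChainsConcrete`
set_option backward.isDefEq.respectTransparency false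

open scoped Manifold ContDiff Topology
open CategoryTheory Limits Set Filter Literature.AlgebraicTopology.SingularHomology Literature.Geometry.Kaehler
  Literature.NumberTheory.Transcendental

universe u

/-! ### The pointwise external product of forms -/

namespace Literature.Geometry.Kaehler.MForm

variable {E : Type u} [NormedAddCommGroup E] [NormedSpace ℝ E] {H : Type u} [TopologicalSpace H]
  {I : ModelWithCorners ℝ E H} {M : Type u} [TopologicalSpace M] [ChartedSpace H M]
  {E' : Type u} [NormedAddCommGroup E'] [NormedSpace ℝ E'] {H' : Type u} [TopologicalSpace H']
  {I' : ModelWithCorners ℝ E' H'} {N : Type u} [TopologicalSpace N] [ChartedSpace H' N]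
  {k k' l : ℕ}

/-- **The external product `π₁^* η ∧ π₂^* β`** of a `k`-form `η` on `M` and an `l`-form `β` on `N`:
a `(k + l)`-form on `M × N` (Bott–Tu (1982), §I.5). [cite: BottTu1982Forms, §I.5] -/
def extProd (η : MForm I M ℝ k) (β : MForm I' N ℝ l) : MForm (I.prod I') (M × N) ℝ (k + l) :=
  (η.pullback (I.prod I') Prod.fst).wedge (β.pullback (I.prod I') Prod.snd)

/-- Unfolding the external product. [folklore] -/
theorem extProd_def (η : MForm I M ℝ k) (β : MForm I' N ℝ l) :
    η.extProd β = (η.pullback (I.prod I') Prod.fst).wedge (β.pullback (I.prod I') Prod.snd) :=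
  rfl

/-- The external product is additive in the first factor. [folklore] -/
theorem extProd_add_left (η η' : MForm I M ℝ k) (β : MForm I' N ℝ l) :
    (η + η').extProd β = η.extProd β + η'.extProd β := by
  rw [extProd, pullback_add, wedge_add_left]
  rfl

/-- The external product commutes with scalars in the first factor. [folklore] -/
theorem extProd_smul_left (c : ℝ) (η : MForm I M ℝ k) (β : MForm I' N ℝ l) :
    (c • η).extProd β = c • η.extProd β := by
  rw [extProd, pullback_smul, wedge_smul_left]
  rfl

/-- The external product of the zero form is zero. [folklore] -/
theorem zero_extProd (β : MForm I' N ℝ l) : (0 : MForm I M ℝ k).extProd β = 0 := by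
  rw [extProd, pullback_zero, zero_wedge]

/-- The external product vanishes at points where the first factor vanishes. [folklore] -/
theorem extProd_apply_eq_zero_of_left {η : MForm I M ℝ k} (β : MForm I' N ℝ l) {p : M × N} (h : η p.1 = 0) :
    η.extProd β p = 0 := by
  have h0 : η.pullback (I.prod I') Prod.fst p = 0 := by
    ext v
    rw [pullback_apply, h]
    rfl
  rw [extProd, wedge_apply, h0]
  exact ContinuousAlternatingMap.zero_wedge _

/-- **The external product commutes with restriction in the first factor**:
`(η|_W) ⊠ β = (η ⊠ β)|_{π₁⁻¹ W}`. [folklore] -/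
theorem extProd_restr_left (W : Set M) (η : MForm I M ℝ k) (β : MForm I' N ℝ l) :
    (η.restr W).extProd β = (η.extProd β).restr (Prod.fst ⁻¹' W) := by
  funext p
  by_cases hp : p.1 ∈ W
  · rw [restr_apply_of_mem _ (show p ∈ Prod.fst ⁻¹' W from hp), extProd, extProd, wedge_apply, wedge_apply]
    have h1 : (η.restr W).pullback (I.prod I') Prod.fst p = η.pullback (I.prod I') Prod.fst p := by
      ext v
      rw [pullback_apply, pullback_apply, restr_apply_of_mem _ hp]
    rw [h1]
  · rw [restr_apply_of_notMem _ (show p ∉ Prod.fst ⁻¹' W from hp)]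
    exact extProd_apply_eq_zero_of_left β (restr_apply_of_notMem η hp)

/-- Degree casts commute with restriction. [folklore] -/
theorem castDeg_restr (h : k = k') (W : Set M) (α : MForm I M ℝ k) : (α.restr W).castDeg h = (α.castDeg h).restr W := by
  subst h
  rfl

/-- Congruence of degree casts at a point. [folklore] -/
theorem castDeg_apply_congr (h : k = k') {α α' : MForm I M ℝ k} {x : M} (hx : α x = α' x) :
    α.castDeg h x = α'.castDeg h x := by
  subst h
  exact hx

variable [IsManifold I ∞ M] [IsManifold I' ∞ N]

/-- **The external product is smooth** at `(x, y)` if `η` is smooth at `x` and `β` at `y` (pull-backs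
along the projections and a wedge, Warner (1983), 2.17 / 2.22, pointwise). [cite: WarnerGTM94, 2.22] -/
theorem smoothAt_extProd {η : MForm I M ℝ k} {β : MForm I' N ℝ l} {p : M × N} (hη : η.SmoothAt p.1)
    (hβ : β.SmoothAt p.2) : (η.extProd β).SmoothAt p :=
  (MForm.SmoothAt.pullback (Eventually.of_forall fun _ ↦ contMDiffAt_fst) hη).wedge
    (MForm.SmoothAt.pullback (Eventually.of_forall fun _ ↦ contMDiffAt_snd) hβ)

/-- **A form on `W` times a smooth form on `N` is a form on `π₁⁻¹ W`.** [cite: BottTu1982Forms, §I.5] -/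
theorem extProd_mem_smoothFormsOn {W : Set M} {η : MForm I M ℝ k} (hη : η ∈ smoothFormsOn I ℝ W k)
    {β : MForm I' N ℝ l} (hβ : IsSmoothForm β) :
    η.extProd β ∈ smoothFormsOn (I.prod I') ℝ (Prod.fst ⁻¹' W) (k + l) :=
  ⟨fun _ hp ↦ smoothAt_extProd (hη.1 _ hp) (hβ _), fun _ hp ↦ extProd_apply_eq_zero_of_left β (hη.2 _ hp)⟩

/-- **Leibniz rule for the external product with a closed form**, pointwise on `W`:
`d(η ⊠ β) = (d_W η) ⊠ β` at the points of `π₁⁻¹ W` (Warner (1983), Thm. 2.20 with `dβ = 0`).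
[cite: WarnerGTM94, Thm. 2.20] -/
theorem mextDeriv_extProd_apply {W : Set M} {η : MForm I M ℝ k} (hη : η ∈ smoothFormsOn I ℝ W k)
    {β : MForm I' N ℝ l} (hβ : β ∈ closedSmoothForms I' N ℝ l) {p : M × N} (hp : p.1 ∈ W) :
    mextDeriv (η.extProd β) p =
      ((((mextDeriv η).restr W).extProd β).castDeg (Nat.add_right_comm k 1 l)) p := by
  have h1 : (η.pullback (I.prod I') Prod.fst).SmoothAt p :=
    MForm.SmoothAt.pullback (Eventually.of_forall fun _ ↦ contMDiffAt_fst) (hη.1 _ hp)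
  have h2 : (β.pullback (I.prod I') Prod.snd).SmoothAt p :=
    MForm.SmoothAt.pullback (Eventually.of_forall fun _ ↦ contMDiffAt_snd) (hβ.1 _)
  rw [extProd, mextDeriv_wedge_apply_of_smoothAt h1 h2]
  -- the second term vanishes: `d(π₂^* β) = π₂^* dβ = 0`
  have hdβ : mextDeriv (β.pullback (I.prod I') (Prod.snd : M × N → N)) = 0 := by
    rw [mextDeriv_pullback contMDiff_snd hβ.1, show mextDeriv β = 0 from hβ.2, pullback_zero]
  rw [hdβ, wedge_zero, smul_zero, Pi.zero_apply, add_zero]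
  -- the first term: `d(π₁^* η) = π₁^*(d_W η)` at `p`
  refine castDeg_apply_congr _ ?_
  have hd : mextDeriv (η.pullback (I.prod I') Prod.fst) p =
      ((mextDeriv η).restr W).pullback (I.prod I') Prod.fst p := by
    rw [mextDeriv_pullback_apply (Eventually.of_forall fun _ ↦ contMDiffAt_fst) (hη.1 _ hp)]
    ext v
    rw [pullback_apply, pullback_apply, restr_apply_of_mem _ hp]
  rw [wedge_apply, hd]
  rfl

end Literature.Geometry.Kaehler.MForm

/-! ### Degree-`q` maps on binary biproducts -/

namespace Literature.AlgebraicTopology.SingularHomology.DegShiftMap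

universe v'

variable {R : Type v'} [CommRing R]
  {K K' L L' : HomologicalComplex (ModuleCat.{max u v'} R) (ComplexShape.down ℕ).symm} {q : ℕ}

/-- The direct sum `φ ⊞ ψ : K ⊞ L → K' ⊞ L'` of two degree-`q` maps. [folklore] -/
def biprod (φ : DegShiftMap K K' q) (ψ : DegShiftMap L L' q) : DegShiftMap (K ⊞ L) (K' ⊞ L') q where
  app i n h :=
    ((Limits.biprod.fst : K ⊞ L ⟶ K).f i ≫ ModuleCat.ofHom (φ.app i n h) ≫ (Limits.biprod.inl : K' ⟶ K' ⊞ L').f n).hom +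
      ((Limits.biprod.snd : K ⊞ L ⟶ L).f i ≫ ModuleCat.ofHom (ψ.app i n h) ≫ (Limits.biprod.inr : L' ⟶ K' ⊞ L').f n).hom
  comm_d i n h x := by
    change (K' ⊞ L').d n (n + 1)
        ((Limits.biprod.inl : K' ⟶ K' ⊞ L').f n (φ.app i n h ((Limits.biprod.fst : K ⊞ L ⟶ K).f i x)) +
          (Limits.biprod.inr : L' ⟶ K' ⊞ L').f n (ψ.app i n h ((Limits.biprod.snd : K ⊞ L ⟶ L).f i x))) =
      (Limits.biprod.inl : K' ⟶ K' ⊞ L').f (n + 1) (φ.app (i + 1) (n + 1) _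
          ((Limits.biprod.fst : K ⊞ L ⟶ K).f (i + 1) ((K ⊞ L).d i (i + 1) x))) +
        (Limits.biprod.inr : L' ⟶ K' ⊞ L').f (n + 1) (ψ.app (i + 1) (n + 1) _
          ((Limits.biprod.snd : K ⊞ L ⟶ L).f (i + 1) ((K ⊞ L).d i (i + 1) x)))
    have e1 : (Limits.biprod.fst : K ⊞ L ⟶ K).f (i + 1) ((K ⊞ L).d i (i + 1) x) =
        K.d i (i + 1) ((Limits.biprod.fst : K ⊞ L ⟶ K).f i x) := by
      rw [← ModuleCat.comp_apply, ← (Limits.biprod.fst : K ⊞ L ⟶ K).comm, ModuleCat.comp_apply]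
    have e2 : (Limits.biprod.snd : K ⊞ L ⟶ L).f (i + 1) ((K ⊞ L).d i (i + 1) x) =
        L.d i (i + 1) ((Limits.biprod.snd : K ⊞ L ⟶ L).f i x) := by
      rw [← ModuleCat.comp_apply, ← (Limits.biprod.snd : K ⊞ L ⟶ L).comm, ModuleCat.comp_apply]
    rw [map_add, e1, e2, ← φ.comm_d, ← ψ.comm_d, ← ModuleCat.comp_apply, (Limits.biprod.inl : K' ⟶ K' ⊞ L').comm,
      ModuleCat.comp_apply, ← ModuleCat.comp_apply ((Limits.biprod.inr : L' ⟶ K' ⊞ L').f n),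
      (Limits.biprod.inr : L' ⟶ K' ⊞ L').comm, ModuleCat.comp_apply]

/-- Unfolding `φ ⊞ ψ`. [folklore] -/
theorem biprod_app (φ : DegShiftMap K K' q) (ψ : DegShiftMap L L' q) {i n : ℕ} (h : i + q = n) (x : (K ⊞ L).X i) :
    (φ.biprod ψ).app i n h x =
      (Limits.biprod.inl : K' ⟶ K' ⊞ L').f n (φ.app i n h ((Limits.biprod.fst : K ⊞ L ⟶ K).f i x)) +
        (Limits.biprod.inr : L' ⟶ K' ⊞ L').f n (ψ.app i n h ((Limits.biprod.snd : K ⊞ L ⟶ L).f i x)) :=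
  rfl

/-- `(φ ⊞ ψ) (inl y) = inl (φ y)`. [folklore] -/
theorem biprod_app_inl (φ : DegShiftMap K K' q) (ψ : DegShiftMap L L' q) {i n : ℕ} (h : i + q = n) (y : K.X i) :
    (φ.biprod ψ).app i n h ((Limits.biprod.inl : K ⟶ K ⊞ L).f i y) =
      (Limits.biprod.inl : K' ⟶ K' ⊞ L').f n (φ.app i n h y) := by
  have h1 : (Limits.biprod.fst : K ⊞ L ⟶ K).f i ((Limits.biprod.inl : K ⟶ K ⊞ L).f i y) = y := by
    rw [← ModuleCat.comp_apply, ← HomologicalComplex.comp_f, Limits.biprod.inl_fst, HomologicalComplex.id_f,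
      ModuleCat.id_apply]
  have h2 : (Limits.biprod.snd : K ⊞ L ⟶ L).f i ((Limits.biprod.inl : K ⟶ K ⊞ L).f i y) = 0 := by
    rw [← ModuleCat.comp_apply, ← HomologicalComplex.comp_f, Limits.biprod.inl_snd, HomologicalComplex.zero_f]
    rfl
  rw [biprod_app, h1, h2, map_zero, map_zero, add_zero]

/-- `(φ ⊞ ψ) (inr z) = inr (ψ z)`. [folklore] -/
theorem biprod_app_inr (φ : DegShiftMap K K' q) (ψ : DegShiftMap L L' q) {i n : ℕ} (h : i + q = n) (z : L.X i) :
    (φ.biprod ψ).app i n h ((Limits.biprod.inr : L ⟶ K ⊞ L).f i z) =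
      (Limits.biprod.inr : L' ⟶ K' ⊞ L').f n (ψ.app i n h z) := by
  have h1 : (Limits.biprod.fst : K ⊞ L ⟶ K).f i ((Limits.biprod.inr : L ⟶ K ⊞ L).f i z) = 0 := by
    rw [← ModuleCat.comp_apply, ← HomologicalComplex.comp_f, Limits.biprod.inr_fst, HomologicalComplex.zero_f]
    rfl
  have h2 : (Limits.biprod.snd : K ⊞ L ⟶ L).f i ((Limits.biprod.inr : L ⟶ K ⊞ L).f i z) = z := by
    rw [← ModuleCat.comp_apply, ← HomologicalComplex.comp_f, Limits.biprod.inr_snd, HomologicalComplex.id_f,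
      ModuleCat.id_apply]
  rw [biprod_app, h1, h2, map_zero, map_zero, zero_add]

end Literature.AlgebraicTopology.SingularHomology.DegShiftMap

namespace Literature.Geometry.Manifold

variable {E : Type u} [NormedAddCommGroup E] [NormedSpace ℝ E] {H : Type u} [TopologicalSpace H]
  {I : ModelWithCorners ℝ E H} {M : Type u} [TopologicalSpace M] [ChartedSpace H M] [IsManifold I ∞ M]
  {E' : Type u} [NormedAddCommGroup E'] [NormedSpace ℝ E'] {H' : Type u} [TopologicalSpace H']
  {I' : ModelWithCorners ℝ E' H'} {N : Type u} [TopologicalSpace N] [ChartedSpace H' N] [IsManifold I' ∞ N]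
  {k l n : ℕ}

/-! ### The external product as a degree-`l` map of de Rham complexes -/

/-- The open set `π₁⁻¹ W ⊆ M × N`. [folklore] -/
theorem isOpen_preimage_fst {W : Set M} (hW : IsOpen W) : IsOpen (Prod.fst ⁻¹' W : Set (M × N)) :=
  hW.preimage continuous_fst

variable (N) in
/-- **The external product with a closed `l`-form `β` on `N`, as a degree-`l` map of de Rham
complexes `Ω•(W) → Ω•(π₁⁻¹ W)`**, `η ↦ π₁^* η ∧ π₂^* β` (Bott–Tu (1982), §I.5).
[cite: BottTu1982Forms, §I.5] -/
def localDeRhamComplex.extProdMap {W : Set M} (hW : IsOpen W) (β : closedSmoothForms I' N ℝ l) :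
    DegShiftMap (localDeRhamComplex I ℝ hW)
      (localDeRhamComplex (I.prod I') ℝ (isOpen_preimage_fst (N := N) hW)) l where
  app k n h :=
    { toFun := fun η ↦ ⟨((η.1 : MForm I M ℝ k).extProd (β.1 : MForm I' N ℝ l)).castDeg h,
        by subst h; exact MForm.extProd_mem_smoothFormsOn η.2 β.2.1⟩
      map_add' := fun η η' ↦ Subtype.ext <| by
        change (((η.1 : MForm I M ℝ k) + η'.1).extProd (β.1 : MForm I' N ℝ l)).castDeg h = _
        rw [MForm.extProd_add_left, MForm.castDeg_add]
        rfl
      map_smul' := fun c η ↦ Subtype.ext <| by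
        change ((c • (η.1 : MForm I M ℝ k)).extProd (β.1 : MForm I' N ℝ l)).castDeg h = _
        rw [MForm.extProd_smul_left, MForm.castDeg_smul]
        rfl }
  comm_d k n h η := by
    subst h
    rw [localDeRhamComplex_d, localDeRhamComplex_d]
    refine Subtype.ext (funext fun p ↦ ?_)
    change (mextDeriv (((η.1 : MForm I M ℝ k).extProd (β.1 : MForm I' N ℝ l)).castDeg rfl)).restr (Prod.fst ⁻¹' W) p =
      ((((mextDeriv (η.1 : MForm I M ℝ k)).restr W).extProd (β.1 : MForm I' N ℝ l)).castDeg _) p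
    rw [MForm.castDeg_rfl]
    by_cases hp : p.1 ∈ W
    · rw [MForm.restr_apply_of_mem _ (show p ∈ Prod.fst ⁻¹' W from hp)]
      exact MForm.mextDeriv_extProd_apply η.2 β.2 hp
    · rw [MForm.restr_apply_of_notMem _ (show p ∉ Prod.fst ⁻¹' W from hp)]
      symm
      have h0 : (((mextDeriv (η.1 : MForm I M ℝ k)).restr W).extProd (β.1 : MForm I' N ℝ l)) p =
          (0 : MForm (I.prod I') (M × N) ℝ _) p :=
        MForm.extProd_apply_eq_zero_of_left _ (MForm.restr_apply_of_notMem _ hp)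
      rw [MForm.castDeg_apply_congr _ h0, MForm.castDeg_zero]
      rfl

/-- The underlying form of the external product map. [folklore] -/
@[simp]
theorem localDeRhamComplex.extProdMap_app_coe {W : Set M} (hW : IsOpen W) (β : closedSmoothForms I' N ℝ l)
    (h : k + l = n) (η : (localDeRhamComplex I ℝ hW).X k) :
    ((localDeRhamComplex.extProdMap N hW β).app k n h η).1 =
      ((η.1 : MForm I M ℝ k).extProd (β.1 : MForm I' N ℝ l)).castDeg h :=
  rfl

variable (N) in
/-- **The external product with the class of `β` on cohomology**:
`extProdH : Hᵏ(Ω•(W)) → Hⁿ(Ω•(π₁⁻¹ W))`, `[η] ↦ [π₁^* η ∧ π₂^* β]` (`k + l = n`).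
[cite: BottTu1982Forms, §I.5] -/
def localDeRhamComplex.extProdH {W : Set M} (hW : IsOpen W) (β : closedSmoothForms I' N ℝ l) (k n : ℕ)
    (h : k + l = n) :
    (localDeRhamComplex I ℝ hW).homology k →ₗ[ℝ]
      (localDeRhamComplex (I.prod I') ℝ (isOpen_preimage_fst (N := N) hW)).homology n :=
  (localDeRhamComplex.extProdMap N hW β).mapH k n h

/-- `extProdH [η] = [π₁^* η ∧ π₂^* β]`. [cite: BottTu1982Forms, §I.5] -/
theorem localDeRhamComplex.extProdH_homologyCls {W : Set M} (hW : IsOpen W) (β : closedSmoothForms I' N ℝ l)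
    (h : k + l = n) (η : (localDeRhamComplex I ℝ hW).X k)
    (hη : (localDeRhamComplex I ℝ hW).d k ((ComplexShape.down ℕ).symm.next k) η = 0) :
    localDeRhamComplex.extProdH N hW β k n h (homologyCls η hη) =
      homologyCls ((localDeRhamComplex.extProdMap N hW β).app k n h η)
        ((localDeRhamComplex.extProdMap N hW β).d_next_app_eq_zero h hη) :=
  (localDeRhamComplex.extProdMap N hW β).mapH_homologyCls h η hη

/-! ### Naturality under restriction -/

/-- The external product map commutes with restriction in the first factor. [folklore] -/
theorem localDeRhamComplex.extProdMap_res {U W : Set M} (hU : IsOpen U) (hW : IsOpen W) (hUW : U ⊆ W)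
    (β : closedSmoothForms I' N ℝ l) (h : k + l = n) (η : (localDeRhamComplex I ℝ hW).X k) :
    (localDeRhamComplex.extProdMap N hU β).app k n h ((localDeRhamComplex.res I ℝ hU hW hUW).f k η) =
      (localDeRhamComplex.res (I.prod I') ℝ (isOpen_preimage_fst (N := N) hU) (isOpen_preimage_fst (N := N) hW)
        (preimage_mono hUW)).f n ((localDeRhamComplex.extProdMap N hW β).app k n h η) := by
  refine Subtype.ext ?_
  rw [localDeRhamComplex.res_f_apply, localDeRhamComplex.res_f_apply]
  change (((η.1 : MForm I M ℝ k).restr U).extProd (β.1 : MForm I' N ℝ l)).castDeg h =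
    (((η.1 : MForm I M ℝ k).extProd (β.1 : MForm I' N ℝ l)).castDeg h).restr (Prod.fst ⁻¹' U)
  rw [MForm.extProd_restr_left, MForm.castDeg_restr]

/-- **`extProdH` commutes with restriction.** [cite: BottTu1982Forms, §I.5] -/
theorem localDeRhamComplex.extProdH_res {U W : Set M} (hU : IsOpen U) (hW : IsOpen W) (hUW : U ⊆ W)
    (β : closedSmoothForms I' N ℝ l) (h : k + l = n) (y : (localDeRhamComplex I ℝ hW).homology k) :
    localDeRhamComplex.extProdH N hU β k n h (HomologicalComplex.homologyMap (localDeRhamComplex.res I ℝ hU hW hUW) k y) =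
      HomologicalComplex.homologyMap (localDeRhamComplex.res (I.prod I') ℝ (isOpen_preimage_fst (N := N) hU)
        (isOpen_preimage_fst (N := N) hW) (preimage_mono hUW)) n (localDeRhamComplex.extProdH N hW β k n h y) :=
  (localDeRhamComplex.extProdMap N hW β).mapH_comm (localDeRhamComplex.extProdMap N hU β) _ _
    (fun _ _ h η ↦ localDeRhamComplex.extProdMap_res hU hW hUW β h η) h y

/-! ### Mayer–Vietoris -/

section MayerVietoris

variable {A B : Set M} (hA : IsOpen A) (hB : IsOpen B) (β : closedSmoothForms I' N ℝ l)

/-- Compatibility of the external product maps with the first map `ω ↦ (ω|_A, ω|_B)` of the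
Mayer–Vietoris sequences of `M` and of `M × N`. [cite: BottTu1982Forms, §I.5] -/
theorem localDeRhamComplex.extProdMap_mv_f (h : k + l = n) (x : (localDeRhamComplex I ℝ (hA.union hB)).X k) :
    ((localDeRhamComplex.extProdMap N hA β).biprod (localDeRhamComplex.extProdMap N hB β)).app k n h
        ((localDeRhamComplex.mvShortComplex I ℝ hA hB).f.f k x) =
      (localDeRhamComplex.mvShortComplex (I.prod I') ℝ (isOpen_preimage_fst (N := N) hA)
          (isOpen_preimage_fst (N := N) hB)).f.f n
        ((localDeRhamComplex.extProdMap N (hA.union hB) β).app k n h x) := by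
  dsimp only [localDeRhamComplex.mvShortComplex]
  rw [lift_f_apply, lift_f_apply, map_add, DegShiftMap.biprod_app_inl, DegShiftMap.biprod_app_inr,
    localDeRhamComplex.extProdMap_res, localDeRhamComplex.extProdMap_res]

/-- Compatibility of the external product maps with the second map `(α, β) ↦ α| - β|` of the
Mayer–Vietoris sequences of `M` and of `M × N`. [cite: BottTu1982Forms, §I.5] -/
theorem localDeRhamComplex.extProdMap_mv_g (h : k + l = n)
    (x : (localDeRhamComplex I ℝ hA ⊞ localDeRhamComplex I ℝ hB).X k) :
    (localDeRhamComplex.extProdMap N (hA.inter hB) β).app k n h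
        ((localDeRhamComplex.mvShortComplex I ℝ hA hB).g.f k x) =
      (localDeRhamComplex.mvShortComplex (I.prod I') ℝ (isOpen_preimage_fst (N := N) hA)
          (isOpen_preimage_fst (N := N) hB)).g.f n
        (((localDeRhamComplex.extProdMap N hA β).biprod (localDeRhamComplex.extProdMap N hB β)).app k n h x) := by
  rw [← biprod_decomp k x]
  dsimp only [localDeRhamComplex.mvShortComplex]
  rw [map_add, map_add, map_add, map_add, desc_f_inl_apply, desc_f_inr_apply, neg_f_apply',
    DegShiftMap.biprod_app_inl, DegShiftMap.biprod_app_inr, desc_f_inl_apply, desc_f_inr_apply, neg_f_apply',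
    map_neg, localDeRhamComplex.extProdMap_res, localDeRhamComplex.extProdMap_res]

/-- **The external product with a closed form commutes with the Mayer–Vietoris connecting
homomorphisms** of the de Rham complexes of `M` (cover `A`, `B`) and of `M × N` (cover `π₁⁻¹ A`,
`π₁⁻¹ B`): `δ (y ⊠ [β]) = (δ y) ⊠ [β]` (Bott–Tu (1982), §I.5, the Mayer–Vietoris argument for
the Künneth formula). [cite: BottTu1982Forms, §I.5] -/
theorem localDeRhamComplex.extProdH_δ [FiniteDimensional ℝ E] [T2Space M] [SecondCountableTopology M]
    [FiniteDimensional ℝ E'] [T2Space N] [SecondCountableTopology N] (h : k + l = n) (y : (localDeRhamComplex I ℝ (hA.inter hB)).homology k) :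
    (localDeRhamComplex.mvShortComplex_shortExact (I := I.prod I') (F := ℝ) (hA := isOpen_preimage_fst (N := N) hA)
        (hB := isOpen_preimage_fst (N := N) hB)).δ n (n + 1) (crel n)
        (localDeRhamComplex.extProdH N (hA.inter hB) β k n h y) =
      localDeRhamComplex.extProdH N (hA.union hB) β (k + 1) (n + 1) (by omega)
        ((localDeRhamComplex.mvShortComplex_shortExact (I := I) (F := ℝ) (hA := hA) (hB := hB)).δ k (k + 1)
          (crel k) y) :=
  DegShiftMap.δ_mapH localDeRhamComplex.mvShortComplex_shortExact localDeRhamComplex.mvShortComplex_shortExact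
    (localDeRhamComplex.extProdMap N (hA.union hB) β)
    ((localDeRhamComplex.extProdMap N hA β).biprod (localDeRhamComplex.extProdMap N hB β))
    (localDeRhamComplex.extProdMap N (hA.inter hB) β)
    (fun _ _ h x ↦ localDeRhamComplex.extProdMap_mv_f hA hB β h x)
    (fun _ _ h x ↦ localDeRhamComplex.extProdMap_mv_g hA hB β h x) h y

end MayerVietoris

/-! ### Naturality in the first factor (maps of pairs) -/

section FirstFactor

variable {E₁ : Type u} [NormedAddCommGroup E₁] [NormedSpace ℝ E₁] {H₁ : Type u} [TopologicalSpace H₁]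
  {I₁ : ModelWithCorners ℝ E₁ H₁} {M₁ : Type u} [TopologicalSpace M₁] [ChartedSpace H₁ M₁] [IsManifold I₁ ∞ M₁]
  {f : M₁ → M} (hf : ContMDiff I₁ I ∞ f) {W₁ : Set M₁} (hW₁ : IsOpen W₁) {W : Set M} (hW : IsOpen W)
  (hfW : MapsTo f W₁ W) (β : closedSmoothForms I' N ℝ l)

omit [IsManifold I ∞ M] [IsManifold I' ∞ N] [IsManifold I₁ ∞ M₁] in
/-- `f × id` is `C^∞`. [folklore] -/
theorem contMDiff_prodMap_id (hf : ContMDiff I₁ I ∞ f) :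
    ContMDiff (I₁.prod I') (I.prod I') ∞ (Prod.map f (id : N → N)) :=
  hf.prodMap contMDiff_id

/-- `f × id` maps `π₁⁻¹ W₁` into `π₁⁻¹ W` when `f` maps `W₁` into `W`. [folklore] -/
theorem mapsTo_prodMap_id {α β γ : Type*} {f : α → γ} {W₁ : Set α} {W : Set γ} (hfW : MapsTo f W₁ W) :
    MapsTo (Prod.map f (id : β → β)) (Prod.fst ⁻¹' W₁) (Prod.fst ⁻¹' W : Set (γ × β)) :=
  fun _ hp ↦ hfW hp

omit [IsManifold I ∞ M] [IsManifold I' ∞ N] [IsManifold I₁ ∞ M₁] in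
include hf in
/-- **The external product is natural in the first factor**, on forms:
`(f^* η) ⊠ β = (f × id)^* (η ⊠ β)`. [cite: BottTu1982Forms, §I.5] -/
theorem _root_.Literature.Geometry.Kaehler.MForm.extProd_pullback_left (η : MForm I M ℝ k) (γ : MForm I' N ℝ l) :
    (η.pullback I₁ f).extProd γ = (η.extProd γ).pullback (I₁.prod I') (Prod.map f (id : N → N)) := by
  have hF := contMDiff_prodMap_id (I' := I') (N := N) hf
  rw [MForm.extProd_def, MForm.extProd_def, MForm.pullback_wedge,
    ← MForm.pullback_comp (contMDiff_fst.mdifferentiable one_ne_zero) (hF.mdifferentiable (by simp)),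
    ← MForm.pullback_comp (contMDiff_snd.mdifferentiable one_ne_zero) (hF.mdifferentiable (by simp)),
    Prod.map_fst', Prod.map_snd', Function.id_comp,
    MForm.pullback_comp (hf.mdifferentiable (by simp)) (contMDiff_fst.mdifferentiable one_ne_zero)]

/-- **The external product maps are natural for maps of pairs in the first factor**: for a `C^∞`
map `f : M₁ → M` with `f(W₁) ⊆ W`, `((f^* η)|_{W₁}) ⊠ β = ((f × id)^* (η ⊠ β))|_{π₁⁻¹ W₁}` on the
de Rham complexes. [cite: BottTu1982Forms, §I.5] -/
theorem localDeRhamComplex.extProdMap_pullbackPair (h : k + l = n) (η : (localDeRhamComplex I ℝ hW).X k) :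
    (localDeRhamComplex.extProdMap N hW₁ β).app k n h ((localDeRhamComplex.pullbackPair I₁ hf hW₁ hW hfW).f k η) =
      (localDeRhamComplex.pullbackPair (I₁.prod I') (contMDiff_prodMap_id (I' := I') (N := N) hf)
        (isOpen_preimage_fst (N := N) hW₁) (isOpen_preimage_fst (N := N) hW) (mapsTo_prodMap_id hfW)).f n
        ((localDeRhamComplex.extProdMap N hW β).app k n h η) := by
  refine Subtype.ext ?_
  change ((((η.1 : MForm I M ℝ k).pullback I₁ f).restr W₁).extProd (β.1 : MForm I' N ℝ l)).castDeg h =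
    ((((η.1 : MForm I M ℝ k).extProd (β.1 : MForm I' N ℝ l)).castDeg h).pullback (I₁.prod I') (Prod.map f id)).restr
      (Prod.fst ⁻¹' W₁)
  rw [MForm.extProd_restr_left, MForm.castDeg_restr, MForm.pullback_castDeg, MForm.extProd_pullback_left hf]

/-- **`extProdH` is natural for maps of pairs in the first factor.** [cite: BottTu1982Forms, §I.5] -/
theorem localDeRhamComplex.extProdH_pullbackPair (h : k + l = n) (y : (localDeRhamComplex I ℝ hW).homology k) :
    localDeRhamComplex.extProdH N hW₁ β k n h
        (HomologicalComplex.homologyMap (localDeRhamComplex.pullbackPair I₁ hf hW₁ hW hfW) k y) =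
      HomologicalComplex.homologyMap (localDeRhamComplex.pullbackPair (I₁.prod I')
        (contMDiff_prodMap_id (I' := I') (N := N) hf) (isOpen_preimage_fst (N := N) hW₁) (isOpen_preimage_fst (N := N) hW)
        (mapsTo_prodMap_id hfW)) n (localDeRhamComplex.extProdH N hW β k n h y) :=
  (localDeRhamComplex.extProdMap N hW β).mapH_comm (localDeRhamComplex.extProdMap N hW₁ β) _ _
    (fun _ _ h η ↦ localDeRhamComplex.extProdMap_pullbackPair hf hW₁ hW hfW β h η) h y

end FirstFactor

/-! ### Naturality in the second factor (maps of pairs) -/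

section SecondFactor

variable {E₂ : Type u} [NormedAddCommGroup E₂] [NormedSpace ℝ E₂] {H₂ : Type u} [TopologicalSpace H₂]
  {I₂ : ModelWithCorners ℝ E₂ H₂} {N₂ : Type u} [TopologicalSpace N₂] [ChartedSpace H₂ N₂] [IsManifold I₂ ∞ N₂]
  {g : N₂ → N} (hg : ContMDiff I₂ I' ∞ g) {W : Set M} (hW : IsOpen W) (β : closedSmoothForms I' N ℝ l)

omit [IsManifold I ∞ M] [IsManifold I' ∞ N] [IsManifold I₂ ∞ N₂] in
/-- `id × g` is `C^∞`. [folklore] -/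
theorem contMDiff_id_prodMap (hg : ContMDiff I₂ I' ∞ g) :
    ContMDiff (I.prod I₂) (I.prod I') ∞ (Prod.map (id : M → M) g) :=
  contMDiff_id.prodMap hg

/-- `id × g` maps `π₁⁻¹ W` into `π₁⁻¹ W`. [folklore] -/
theorem mapsTo_id_prodMap {α β γ : Type*} (g : β → γ) (W : Set α) :
    MapsTo (Prod.map (id : α → α) g) (Prod.fst ⁻¹' W) (Prod.fst ⁻¹' W : Set (α × γ)) :=
  fun _ hp ↦ hp

omit [IsManifold I ∞ M] [IsManifold I' ∞ N] [IsManifold I₂ ∞ N₂] in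
include hg in
/-- **The external product is natural in the second factor**, on forms:
`η ⊠ (g^* γ) = (id × g)^* (η ⊠ γ)`. [cite: BottTu1982Forms, §I.5] -/
theorem _root_.Literature.Geometry.Kaehler.MForm.extProd_pullback_right (η : MForm I M ℝ k) (γ : MForm I' N ℝ l) :
    η.extProd (γ.pullback I₂ g) = (η.extProd γ).pullback (I.prod I₂) (Prod.map (id : M → M) g) := by
  have hG := contMDiff_id_prodMap (I := I) (M := M) hg
  rw [MForm.extProd_def, MForm.extProd_def, MForm.pullback_wedge,
    ← MForm.pullback_comp (contMDiff_fst.mdifferentiable one_ne_zero) (hG.mdifferentiable (by simp)),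
    ← MForm.pullback_comp (contMDiff_snd.mdifferentiable one_ne_zero) (hG.mdifferentiable (by simp)),
    Prod.map_fst', Prod.map_snd', Function.id_comp,
    MForm.pullback_comp (hg.mdifferentiable (by simp)) (contMDiff_snd.mdifferentiable one_ne_zero)]

/-- The pull-back `g^* β` of the closed form, a closed form on `N₂`. [cite: WarnerGTM94, 2.23] -/
def pullbackClosed (hg : ContMDiff I₂ I' ∞ g) (β : closedSmoothForms I' N ℝ l) : closedSmoothForms I₂ N₂ ℝ l :=
  ⟨(β.1 : MForm I' N ℝ l).pullback I₂ g, pullback_mem_closedSmoothForms hg β.2⟩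

/-- The underlying form of `pullbackClosed`. [folklore] -/
@[simp]
theorem coe_pullbackClosed : (pullbackClosed hg β).1 = (β.1 : MForm I' N ℝ l).pullback I₂ g := rfl

omit [IsManifold I ∞ M] in
/-- A form on `W` is its own restriction to `W`. [folklore] -/
theorem coe_eq_restr_of_mem_smoothFormsOn {W : Set M} {η : MForm I M ℝ k} (hη : η ∈ smoothFormsOn I ℝ W k) :
    η = η.restr W := by
  funext x
  by_cases hx : x ∈ W
  · rw [MForm.restr_apply_of_mem _ hx]
  · rw [MForm.restr_apply_of_notMem _ hx, hη.2 x hx]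

/-- **The external product maps are natural in the second factor**: `η ⊠ (g^* β) = ((id × g)^* (η ⊠ β))|`
on the de Rham complexes of `π₁⁻¹ W`. [cite: BottTu1982Forms, §I.5] -/
theorem localDeRhamComplex.extProdMap_pullbackPair_snd (h : k + l = n) (η : (localDeRhamComplex I ℝ hW).X k) :
    (localDeRhamComplex.extProdMap N₂ hW (pullbackClosed hg β)).app k n h η =
      (localDeRhamComplex.pullbackPair (I.prod I₂) (contMDiff_id_prodMap (I := I) (M := M) hg)
        (isOpen_preimage_fst (N := N₂) hW) (isOpen_preimage_fst (N := N) hW) (mapsTo_id_prodMap g W)).f n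
        ((localDeRhamComplex.extProdMap N hW β).app k n h η) := by
  refine Subtype.ext ?_
  change ((η.1 : MForm I M ℝ k).extProd ((β.1 : MForm I' N ℝ l).pullback I₂ g)).castDeg h =
    ((((η.1 : MForm I M ℝ k).extProd (β.1 : MForm I' N ℝ l)).castDeg h).pullback (I.prod I₂) (Prod.map id g)).restr
      (Prod.fst ⁻¹' W)
  have hη := coe_eq_restr_of_mem_smoothFormsOn η.2
  rw [MForm.pullback_castDeg, ← MForm.extProd_pullback_right hg, ← MForm.castDeg_restr, ← MForm.extProd_restr_left, ← hη]

/-- **`extProdH` is natural in the second factor.** [cite: BottTu1982Forms, §I.5] -/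
theorem localDeRhamComplex.extProdH_pullbackPair_snd (h : k + l = n) (y : (localDeRhamComplex I ℝ hW).homology k) :
    localDeRhamComplex.extProdH N₂ hW (pullbackClosed hg β) k n h y =
      HomologicalComplex.homologyMap (localDeRhamComplex.pullbackPair (I.prod I₂)
        (contMDiff_id_prodMap (I := I) (M := M) hg) (isOpen_preimage_fst (N := N₂) hW) (isOpen_preimage_fst (N := N) hW)
        (mapsTo_id_prodMap g W)) n (localDeRhamComplex.extProdH N hW β k n h y) := by
  have key := (localDeRhamComplex.extProdMap N hW β).mapH_comm
    (localDeRhamComplex.extProdMap N₂ hW (pullbackClosed hg β)) (𝟙 _) _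
    (fun _ _ h η ↦ localDeRhamComplex.extProdMap_pullbackPair_snd hg hW β h η) h y
  rw [HomologicalComplex.homologyMap_id] at key
  exact key

end SecondFactor

end Literature.Geometry.Manifold
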